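import Summits.KontsevichZagierPeriods.KontsevichZagierPeriods.Theorems.LinRedNormalFormArrangementNormalFormStubRebaseSimplePosOneFibreParNonpinch
import Summits.KontsevichZagierPeriods.KontsevichZagierPeriods.Theorems.LinRedNormalFormArrangementNormalFormSeparateDominated

/-!
# Stub `stub_rebaseSimplePosOneZero`, residual hypothesis `Hpar` (crux `ArrangementNormalForm`,
line `janus-bands`, v10) — sub-part `ParCells`: dissection of the base cell into PRODUCT cells

**Rule 1a on the order of the `y`-bounds of the base cell.** A one-fibre literal datum over a
bounded base cell `{M-rows > 0} ⊆ ℝ^{B+1}` (fibre bounds `u`, `v`) is congruent modulo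
`KZ.relations` to the sum of its restrictions to the PRODUCT CELLS
`{x' : P is the largest lower y-bound, S the smallest upper y-bound} × (P(x'), S(x'))`,
indexed by the pairs `(P, S)` of a lower and an upper `y`-bound of the cell (the rows of `M`
solved for `y`; two constant bounds `∓R` implied by boundedness are added so that both families
are non-empty): the ties are null hyperplanes, the pieces are disjoint, and every piece has a
LITERAL domain whose rows are `y`-free except for the two bounds `y − P > 0`, `S − y > 0` —
exactly the hypothesis `hsec` of the product-cell theorems `rebaseSimplePos_par_nonpinch` /
`rebaseSimplePos_par_level`. Stated with a per-cell CALLBACK (`RebasePos.par_cells`, registered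
as `rebaseSimplePos_par_cells`): each cell is handed over with its literal rows, the explicit
`x'`-rows / `y`-bounds of `hsec`, its inclusion in the original domain and in the original base
cell.

References: M. Kontsevich, D. Zagier, *Periods* (2001), §1.2, rule (1a).
-/

noncomputable section

open Set MeasureTheory MvPolynomial
open Literature.NumberTheory.Transcendental Literature.ModelTheory.ExponentialFields

namespace Summit.KontsevichZagierPeriods.ArrangementNormalForm.JanusBands

namespace RebasePos

open SeparatePos

section Cells

variable {B m' : ℕ}

/-- A lifted non-zero `x'`-form is non-zero. -/
theorem liftB_ne_zero {d : (Fin B → ℚ) × ℚ} (hd : d ≠ 0) :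
    (((Fin.snoc d.1 0 : Fin (B + 1) → ℚ), d.2) : (Fin (B + 1) → ℚ) × ℚ) ≠ 0 := by
  intro h
  apply hd
  have h1 : (Fin.snoc d.1 0 : Fin (B + 1) → ℚ) = 0 := congrArg Prod.fst h
  have h2 : d.2 = 0 := congrArg Prod.snd h
  refine Prod.ext (funext fun i => ?_) h2
  have := congrFun h1 (Fin.castSucc i)
  simpa using this

/-- A constant `x'`-form evaluates to its constant. -/
theorem affB_const (c : ℚ) (z : Fin (B + 1 + 1) → ℝ) :
    affB B 1 (((0 : Fin B → ℚ), c) : (Fin B → ℚ) × ℚ) z = c := by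
  simp [affB]

/-- The level set of a non-zero `x'`-form is null. -/
theorem volume_affB_eq_zero {d : (Fin B → ℚ) × ℚ} (hd : d ≠ 0) :
    volume {z : Fin (B + 1 + 1) → ℝ | affB B 1 d z = 0} = 0 := by
  have h := volume_form_eq_zero (k := 1) _ (liftB_ne_zero hd)
  convert h using 2
  ext z
  rw [mem_setOf_eq, mem_setOf_eq, ← affF_liftB d z]
  rfl

/-- Rows read through `Finset.equivFin`. -/
theorem forall_equivFin {α : Type*} (F : Finset α) (Q : α → Prop) :
    (∀ i : Fin F.card, Q (F.equivFin.symm i).1) ↔ ∀ c ∈ F, Q c :=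
  ⟨fun h c hc => by simpa using h (F.equivFin ⟨c, hc⟩), fun h i => h _ (F.equivFin.symm i).2⟩

/-- **Dissection of the base cell into product cells** (rule 1a, with a per-cell callback).
See the module docstring. -/
theorem par_cells {S : Set KZ.FormalRep} (s : KZ.IntegralRep (B + 1 + 1))
    (M : Fin m' → (Fin (B + 1) → ℚ) × ℚ) (u v : (Fin (B + 1) → ℚ) × ℚ)
    (hbd : Bornology.IsBounded s.domain)
    (hdom : s.domain = gDom B 1 m' M (fun _ => Sum.inr u) (fun _ => Sum.inr v))
    (hpiece : ∀ (m'' m₀ : ℕ) (s' : KZ.IntegralRep (B + 1 + 1)) (M' : Fin m'' → (Fin (B + 1) → ℚ) × ℚ)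
      (M₀ : Fin m₀ → (Fin B → ℚ) × ℚ) (ylo yhi : (Fin B → ℚ) × ℚ),
      s'.domain ⊆ s.domain → s'.integrand = s.integrand →
      s'.domain = gDom B 1 m'' M' (fun _ => Sum.inr u) (fun _ => Sum.inr v) →
      (∀ z : Fin (B + 1 + 1) → ℝ, (∀ j, 0 < affF B 1 (M' j) z) ↔ ((∀ j, 0 < affB B 1 (M₀ j) z) ∧
        affB B 1 ylo z < z (Fin.castAdd 1 (Fin.last B)) ∧
        z (Fin.castAdd 1 (Fin.last B)) < affB B 1 yhi z)) →
      (∀ z : Fin (B + 1 + 1) → ℝ, (∀ j, 0 < affF B 1 (M' j) z) → ∀ j, 0 < affF B 1 (M j) z) →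
      ∃ c ∈ AddSubgroup.closure S, KZ.of s' - c ∈ KZ.relations) :
    ∃ c ∈ AddSubgroup.closure S, KZ.of s - c ∈ KZ.relations := by
  classical
  -- a rational bound on `|y|` over the domain
  obtain ⟨C, hC⟩ := isBounded_iff_forall_norm_le.mp hbd
  set R : ℕ := ⌈C⌉₊ + 1 with hR
  have hyR : ∀ z ∈ s.domain, |z (Fin.castAdd 1 (Fin.last B))| < R := fun z hz => by
    have h := (norm_le_pi_norm z (Fin.castAdd 1 (Fin.last B))).trans (hC z hz)
    rw [Real.norm_eq_abs] at h
    have hc : C ≤ ⌈C⌉₊ := Nat.le_ceil C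
    rw [hR]
    push_cast
    linarith
  -- the `y`-free rows, the lower and the upper `y`-bounds
  set y : (Fin (B + 1 + 1) → ℝ) → ℝ := fun z => z (Fin.castAdd 1 (Fin.last B)) with hy
  set ZRs : Finset ((Fin B → ℚ) × ℚ) :=
    (Finset.univ.filter fun j => (M j).1 (Fin.last B) = 0).image fun j => restr B (M j) with hZRs
  set LWs : Finset ((Fin B → ℚ) × ℚ) :=
    ((Finset.univ.filter fun j => 0 < (M j).1 (Fin.last B)).image fun j => root B (M j)) ∪
      {((0 : Fin B → ℚ), -(R : ℚ))} with hLWs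
  set UPs : Finset ((Fin B → ℚ) × ℚ) :=
    ((Finset.univ.filter fun j => (M j).1 (Fin.last B) < 0).image fun j => root B (M j)) ∪
      {((0 : Fin B → ℚ), (R : ℚ))} with hUPs
  have hLWne : LWs.Nonempty := ⟨(0, -(R : ℚ)), by simp [hLWs]⟩
  have hUPne : UPs.Nonempty := ⟨(0, (R : ℚ)), by simp [hUPs]⟩
  -- the rows of `M`, solved for `y`
  have hrowsM : ∀ z : Fin (B + 1 + 1) → ℝ, ((∀ j, 0 < affF B 1 (M j) z) ∧ |y z| < R) ↔
      ((∀ ρ ∈ ZRs, 0 < affB B 1 ρ z) ∧ (∀ P ∈ LWs, affB B 1 P z < y z) ∧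
        ∀ S' ∈ UPs, y z < affB B 1 S' z) := by
    intro z
    simp only [hZRs, hLWs, hUPs, Finset.forall_mem_union, Finset.forall_mem_image,
      Finset.mem_filter, Finset.mem_univ, true_and, Finset.mem_singleton, forall_eq, affB_const,
      Rat.cast_neg, Rat.cast_natCast, abs_lt, hy]
    constructor
    · rintro ⟨hrow, hR₁, hR₂⟩
      refine ⟨fun j hj => ?_, ⟨fun j hj => ?_, hR₁⟩, fun j hj => ?_, hR₂⟩
      · rw [← affF_of_eq_zero _ _ hj]; exact hrow j
      · have h := hrow j
        rw [affF_of_ne_zero _ _ hj.ne'] at h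
        have hc : (0 : ℝ) < (M j).1 (Fin.last B) := by exact_mod_cast hj
        have := (mul_pos_iff_of_pos_left hc).1 h
        linarith
      · have h := hrow j
        rw [affF_of_ne_zero _ _ hj.ne] at h
        have hc : ((M j).1 (Fin.last B) : ℝ) < 0 := by exact_mod_cast hj
        have := (mul_pos_iff.1 h).resolve_left (fun h' => absurd h'.1 (not_lt.2 hc.le))
        linarith [this.2]
    · rintro ⟨hZ, ⟨hL, hR₁⟩, hU, hR₂⟩
      refine ⟨fun j => ?_, hR₁, hR₂⟩
      rcases lt_trichotomy ((M j).1 (Fin.last B)) 0 with hj | hj | hj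
      · rw [affF_of_ne_zero _ _ hj.ne]
        have hc : ((M j).1 (Fin.last B) : ℝ) < 0 := by exact_mod_cast hj
        exact mul_pos_of_neg_of_neg hc (by linarith [hU hj])
      · rw [affF_of_eq_zero _ _ hj]; exact hZ hj
      · rw [affF_of_ne_zero _ _ hj.ne']
        have hc : (0 : ℝ) < (M j).1 (Fin.last B) := by exact_mod_cast hj
        exact mul_pos hc (by linarith [hL hj])
  -- the literal rows of the piece `(P, S)`
  set rowsF : ((Fin B → ℚ) × ℚ) × ((Fin B → ℚ) × ℚ) → Finset ((Fin (B + 1) → ℚ) × ℚ) :=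
    fun idx => ((ZRs.image fun d => (((Fin.snoc d.1 0 : Fin (B + 1) → ℚ), d.2) : (Fin (B + 1) → ℚ) × ℚ)) ∪
      ((LWs.erase idx.1).image fun P' => (((Fin.snoc (idx.1 - P').1 0 : Fin (B + 1) → ℚ),
        (idx.1 - P').2) : (Fin (B + 1) → ℚ) × ℚ)) ∪
      ((UPs.erase idx.2).image fun S' => (((Fin.snoc (S' - idx.2).1 0 : Fin (B + 1) → ℚ),
        (S' - idx.2).2) : (Fin (B + 1) → ℚ) × ℚ))) ∪
      {(((Fin.snoc (-idx.1).1 1 : Fin (B + 1) → ℚ), (-idx.1).2) : (Fin (B + 1) → ℚ) × ℚ),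
        (((Fin.snoc idx.2.1 (-1) : Fin (B + 1) → ℚ), idx.2.2) : (Fin (B + 1) → ℚ) × ℚ)}
    with hrowsF
  -- the `x'`-rows of the piece `(P, S)`
  set rows₀ : ((Fin B → ℚ) × ℚ) × ((Fin B → ℚ) × ℚ) → Finset ((Fin B → ℚ) × ℚ) :=
    fun idx => ZRs ∪ ((LWs.erase idx.1).image fun P' => idx.1 - P') ∪
      ((UPs.erase idx.2).image fun S' => S' - idx.2) with hrows₀
  have hrows₀' : ∀ idx (z : Fin (B + 1 + 1) → ℝ), (∀ ρ ∈ rows₀ idx, 0 < affB B 1 ρ z) ↔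
      ((∀ ρ ∈ ZRs, 0 < affB B 1 ρ z) ∧ (∀ P' ∈ LWs.erase idx.1, affB B 1 P' z < affB B 1 idx.1 z) ∧
        ∀ S' ∈ UPs.erase idx.2, affB B 1 idx.2 z < affB B 1 S' z) := by
    intro idx z
    simp only [hrows₀, Finset.forall_mem_union, Finset.forall_mem_image, affB_sub, sub_pos, and_assoc]
  have hsnoc : ∀ (d : (Fin B → ℚ) × ℚ) (c : ℚ) (z : Fin (B + 1 + 1) → ℝ),
      affF B 1 (((Fin.snoc d.1 c : Fin (B + 1) → ℚ), d.2) : (Fin (B + 1) → ℚ) × ℚ) z =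
      (c : ℝ) * z (Fin.castAdd 1 (Fin.last B)) + affB B 1 d z := fun d c z => by
    simp only [affF, affB, Fin.sum_univ_castSucc, Fin.snoc_castSucc, Fin.snoc_last]
    ring
  have hrowsF' : ∀ idx (z : Fin (B + 1 + 1) → ℝ), (∀ c ∈ rowsF idx, 0 < affF B 1 c z) ↔
      ((∀ ρ ∈ ZRs, 0 < affB B 1 ρ z) ∧ (∀ P' ∈ LWs.erase idx.1, affB B 1 P' z < affB B 1 idx.1 z) ∧
        (∀ S' ∈ UPs.erase idx.2, affB B 1 idx.2 z < affB B 1 S' z) ∧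
        affB B 1 idx.1 z < y z ∧ y z < affB B 1 idx.2 z) := by
    intro idx z
    simp only [hrowsF, Finset.forall_mem_union, Finset.forall_mem_image, Finset.forall_mem_insert,
      Finset.mem_singleton, forall_eq, hsnoc, Rat.cast_zero, zero_mul, zero_add, Rat.cast_one,
      one_mul, Rat.cast_neg, neg_mul, affB_sub, affB_neg', sub_pos, hy, and_assoc]
    constructor
    · rintro ⟨hZ, hL, hU, h1, h2⟩
      exact ⟨hZ, hL, hU, by linarith, by linarith⟩
    · rintro ⟨hZ, hL, hU, h1, h2⟩
      exact ⟨hZ, hL, hU, by linarith, by linarith⟩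
  -- Fin-indexed versions
  set MP : ∀ idx : ((Fin B → ℚ) × ℚ) × ((Fin B → ℚ) × ℚ), Fin (rowsF idx).card →
      (Fin (B + 1) → ℚ) × ℚ := fun idx i => ((rowsF idx).equivFin.symm i).1 with hMP
  set M₀ : ∀ idx : ((Fin B → ℚ) × ℚ) × ((Fin B → ℚ) × ℚ), Fin (rows₀ idx).card →
      (Fin B → ℚ) × ℚ := fun idx i => ((rows₀ idx).equivFin.symm i).1 with hM₀
  have hMP' : ∀ idx (z : Fin (B + 1 + 1) → ℝ), (∀ i, 0 < affF B 1 (MP idx i) z) ↔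
      ((∀ ρ ∈ ZRs, 0 < affB B 1 ρ z) ∧ (∀ P' ∈ LWs.erase idx.1, affB B 1 P' z < affB B 1 idx.1 z) ∧
        (∀ S' ∈ UPs.erase idx.2, affB B 1 idx.2 z < affB B 1 S' z) ∧
        affB B 1 idx.1 z < y z ∧ y z < affB B 1 idx.2 z) :=
    fun idx z => by
      rw [← hrowsF']
      exact forall_equivFin (rowsF idx) (fun c => 0 < affF B 1 c z)
  have hM₀' : ∀ idx (z : Fin (B + 1 + 1) → ℝ), (∀ i, 0 < affB B 1 (M₀ idx i) z) ↔
      ∀ ρ ∈ rows₀ idx, 0 < affB B 1 ρ z :=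
    fun idx z => forall_equivFin (rows₀ idx) (fun c => 0 < affB B 1 c z)
  -- the base cell of a piece lies in the original base cell
  have hbase : ∀ idx, idx.1 ∈ LWs → idx.2 ∈ UPs → ∀ z : Fin (B + 1 + 1) → ℝ,
      (∀ i, 0 < affF B 1 (MP idx i) z) → (∀ j, 0 < affF B 1 (M j) z) ∧ |y z| < R := by
    intro idx hP hS z hz
    rw [hMP'] at hz
    obtain ⟨hZ, hL, hU, hPy, hyS⟩ := hz
    refine (hrowsM z).2 ⟨hZ, fun P' hP' => ?_, fun S' hS' => ?_⟩
    · by_cases h : P' = idx.1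
      · rw [h]; exact hPy
      · exact (hL P' (Finset.mem_erase.2 ⟨h, hP'⟩)).trans hPy
    · by_cases h : S' = idx.2
      · rw [h]; exact hyS
      · exact hyS.trans (hU S' (Finset.mem_erase.2 ⟨h, hS'⟩))
  -- the pieces
  set pc : ((Fin B → ℚ) × ℚ) × ((Fin B → ℚ) × ℚ) → Set (Fin (B + 1 + 1) → ℝ) := fun idx =>
    gDom B 1 (rowsF idx).card (MP idx) (fun _ => Sum.inr u) (fun _ => Sum.inr v) with hpc
  set T : Finset (((Fin B → ℚ) × ℚ) × ((Fin B → ℚ) × ℚ)) := LWs ×ˢ UPs with hT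
  have hpcsub : ∀ idx ∈ T, pc idx ⊆ s.domain := by
    intro idx hidx z hz
    rw [hT, Finset.mem_product] at hidx
    simp only [hpc, mem_gDom_one] at hz
    rw [hdom, mem_gDom_one]
    exact ⟨(hbase idx hidx.1 hidx.2 z hz.1).1, hz.2⟩
  set Rp : ((Fin B → ℚ) × ℚ) × ((Fin B → ℚ) × ℚ) → KZ.IntegralRep (B + 1 + 1) := fun idx =>
    if h : idx ∈ T then s.restrict (pc idx) (isSemialgebraic_gDom _ _ _ _) (hpcsub idx h) else s
    with hRp
  have hRp_dom : ∀ idx ∈ T, (Rp idx).domain = pc idx := fun idx h => by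
    simp only [hRp, dif_pos h, KZ.IntegralRep.domain_restrict]
  have hRp_int : ∀ idx ∈ T, (Rp idx).integrand = s.integrand := fun idx h => by
    simp only [hRp, dif_pos h, KZ.IntegralRep.integrand_restrict]
  -- the ties
  set Ties : Set (Fin (B + 1 + 1) → ℝ) :=
    (⋃ P ∈ LWs, ⋃ P' ∈ LWs.erase P, {z | affB B 1 (P - P') z = 0}) ∪
    (⋃ S' ∈ UPs, ⋃ S'' ∈ UPs.erase S', {z | affB B 1 (S' - S'') z = 0}) with hTies
  have hTies0 : volume Ties = 0 := by
    refine measure_union_null ?_ ?_ <;>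
      refine (measure_biUnion_null_iff (Finset.countable_toSet _)).mpr fun P _ =>
        (measure_biUnion_null_iff (Finset.countable_toSet _)).mpr fun P' hP' =>
          volume_affB_eq_zero (sub_ne_zero.mpr ?_) <;>
      exact fun h => (Finset.mem_erase.mp hP').1 h.symm
  -- covering
  have hcov : s.domain \ (⋃ idx ∈ T, (Rp idx).domain) ⊆ Ties := by
    rintro z ⟨hz, hzU⟩
    have hzM : ∀ j, 0 < affF B 1 (M j) z := by rw [hdom, mem_gDom_one] at hz; exact hz.1
    have hfib : affF B 1 u z < z (Fin.natAdd (B + 1) 0) ∧ z (Fin.natAdd (B + 1) 0) < affF B 1 v z := by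
      rw [hdom, mem_gDom_one] at hz; exact hz.2
    obtain ⟨hZ, hL, hU⟩ := (hrowsM z).1 ⟨hzM, hyR z hz⟩
    obtain ⟨P₀, hP₀, hP₀max⟩ := Finset.exists_max_image LWs (fun P => affB B 1 P z) hLWne
    obtain ⟨S₀, hS₀, hS₀min⟩ := Finset.exists_min_image UPs (fun S' => affB B 1 S' z) hUPne
    by_cases htP : ∃ P' ∈ LWs.erase P₀, affB B 1 P' z = affB B 1 P₀ z
    · obtain ⟨P', hP', hP'e⟩ := htP
      refine Or.inl ?_
      simp only [mem_iUnion]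
      exact ⟨P₀, hP₀, P', hP', by simp only [mem_setOf_eq, affB_sub, hP'e, sub_self]⟩
    by_cases htS : ∃ S' ∈ UPs.erase S₀, affB B 1 S' z = affB B 1 S₀ z
    · obtain ⟨S', hS', hS'e⟩ := htS
      refine Or.inr ?_
      simp only [mem_iUnion]
      exact ⟨S₀, hS₀, S', hS', by simp only [mem_setOf_eq, affB_sub, hS'e, sub_self]⟩
    push Not at htP htS
    refine absurd (mem_iUnion₂.mpr ⟨(P₀, S₀), by simp [hT, hP₀, hS₀], ?_⟩) hzU
    rw [hRp_dom _ (by simp [hT, hP₀, hS₀])]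
    simp only [hpc, mem_gDom_one, hMP']
    refine ⟨⟨hZ, fun P' hP' => lt_of_le_of_ne (hP₀max P' (Finset.mem_erase.1 hP').2) (htP P' hP'),
      fun S' hS' => lt_of_le_of_ne (hS₀min S' (Finset.mem_erase.1 hS').2) (htS S' hS').symm,
      hL P₀ hP₀, hU S₀ hS₀⟩, hfib⟩
  -- disjointness
  have hdisj : (T : Set (((Fin B → ℚ) × ℚ) × ((Fin B → ℚ) × ℚ))).Pairwise
      fun i j => volume ((Rp i).domain ∩ (Rp j).domain) = 0 := by
    intro idx hidx idx' hidx' hne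
    rw [Finset.mem_coe] at hidx hidx'
    rw [hRp_dom _ hidx, hRp_dom _ hidx']
    rw [show pc idx ∩ pc idx' = ∅ from ?_, measure_empty]
    refine Set.eq_empty_of_forall_notMem fun z hz => hne ?_
    obtain ⟨hz₁, hz₂⟩ := hz
    simp only [hpc, mem_gDom_one, hMP'] at hz₁ hz₂
    obtain ⟨⟨-, hL, hU, -, -⟩, -⟩ := hz₁
    obtain ⟨⟨-, hL', hU', -, -⟩, -⟩ := hz₂
    rw [hT, Finset.mem_product] at hidx hidx'
    have h1 : idx.1 = idx'.1 := by
      by_contra h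
      exact lt_asymm (hL idx'.1 (Finset.mem_erase.2 ⟨Ne.symm h, hidx'.1⟩))
        (hL' idx.1 (Finset.mem_erase.2 ⟨h, hidx.1⟩))
    have h2 : idx.2 = idx'.2 := by
      by_contra h
      exact lt_asymm (hU idx'.2 (Finset.mem_erase.2 ⟨Ne.symm h, hidx'.2⟩))
        (hU' idx.2 (Finset.mem_erase.2 ⟨h, hidx.2⟩))
    exact Prod.ext h1 h2
  have hsplit : KZ.of s - ∑ idx ∈ T, KZ.of (Rp idx) ∈ KZ.relations := by
    refine KZ.of_sub_sum_of_mem_relations T s Rp (fun idx hidx => ?_)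
      (fun idx hidx z _ => by rw [hRp_int idx hidx]) (measure_mono_null hcov hTies0) hdisj
    rw [hRp_dom idx hidx, show pc idx \ s.domain = ∅ from Set.sdiff_eq_empty.mpr (hpcsub idx hidx),
      measure_empty]
  -- the callback on each piece
  have hgood : ∀ idx ∈ T, ∃ c ∈ AddSubgroup.closure S, KZ.of (Rp idx) - c ∈ KZ.relations := by
    intro idx hidx
    have hidx' := hidx
    rw [hT, Finset.mem_product] at hidx'
    refine hpiece (rowsF idx).card (rows₀ idx).card (Rp idx) (MP idx) (M₀ idx) idx.1 idx.2
      (by rw [hRp_dom idx hidx]; exact hpcsub idx hidx) (hRp_int idx hidx) (hRp_dom idx hidx)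
      (fun z => by simp only [hMP', hM₀', hrows₀', hy, and_assoc])
      fun z hz => (hbase idx hidx'.1 hidx'.2 z hz).1
  choose! cc hcc using hgood
  refine ⟨∑ idx ∈ T, cc idx, AddSubgroup.sum_mem _ fun idx hidx => (hcc idx hidx).1, ?_⟩
  have hsum : ∑ idx ∈ T, (KZ.of (Rp idx) - cc idx) ∈ KZ.relations :=
    sum_mem fun idx hidx => (hcc idx hidx).2
  have key := KZ.relations.add_mem hsplit hsum
  rw [Finset.sum_sub_distrib] at key
  convert key using 1
  abel

end Cells

end RebasePos

/-- **Registered part of `stub_rebaseSimplePosOneZero`, residual hypothesis `Hpar` (line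
`janus-bands`, v10): dissection of the base cell into PRODUCT cells** (rule 1a). A one-fibre
literal datum over a bounded base cell `{M-rows > 0}` in `ℝ^{B+1}` with affine fibre bounds
`u`, `v` is congruent modulo `KZ.relations` to the subgroup generated by any set `S` as soon as
each of its PRODUCT CELLS is: the restrictions to
`{x' : P is the largest lower y-bound, S the smallest upper y-bound} × (P(x'), S(x'))` over
the pairs `(P, S)` of `y`-bounds of the cell (rows of `M` solved for `y`, plus two constant
bounds from boundedness), each handed over with a literal domain, the explicit `x'`-rows and
`y`-bounds of the product structure (`hsec`), and its inclusion in the original domain and base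
cell (`RebasePos.par_cells`: ties are null hyperplanes, pieces are disjoint). -/
theorem rebaseSimplePos_par_cells (B m' : ℕ) (S : Set KZ.FormalRep) (s : KZ.IntegralRep (B + 1 + 1)) (M : Fin m' → (Fin (B + 1) → ℚ) × ℚ) (u v : (Fin (B + 1) → ℚ) × ℚ) (hbd : Bornology.IsBounded s.domain) (hdom : s.domain = SeparatePos.gDom B 1 m' M (fun _ => Sum.inr u) (fun _ => Sum.inr v)) (hpiece : ∀ (m'' m₀ : ℕ) (s' : KZ.IntegralRep (B + 1 + 1)) (M' : Fin m'' → (Fin (B + 1) → ℚ) × ℚ) (M₀ : Fin m₀ → (Fin B → ℚ) × ℚ) (ylo yhi : (Fin B → ℚ) × ℚ), s'.domain ⊆ s.domain → s'.integrand = s.integrand → s'.domain = SeparatePos.gDom B 1 m'' M' (fun _ => Sum.inr u) (fun _ => Sum.inr v) → (∀ z : Fin (B + 1 + 1) → ℝ, (∀ j, 0 < SeparatePos.affF B 1 (M' j) z) ↔ ((∀ j, 0 < SeparatePos.affB B 1 (M₀ j) z) ∧ SeparatePos.affB B 1 ylo z < z (Fin.castAdd 1 (Fin.last B)) ∧ z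 (Fin.castAdd 1 (Fin.last B)) < SeparatePos.affB B 1 yhi z)) → (∀ z : Fin (B + 1 + 1) → ℝ, (∀ j, 0 < SeparatePos.affF B 1 (M' j) z) → ∀ j, 0 < SeparatePos.affF B 1 (M j) z) → ∃ c ∈ AddSubgroup.closure S, KZ.of s' - c ∈ KZ.relations) : ∃ c ∈ AddSubgroup.closure S, KZ.of s - c ∈ KZ.relations :=
  RebasePos.par_cells s M u v hbd hdom hpiece

end Summit.KontsevichZagierPeriods.ArrangementNormalForm.JanusBands
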